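import Literature.NumberTheory.Sieve.HeathBrownCubicFLSequencesA
import Literature.NumberTheory.Sieve.HeathBrownCubicNormWindowSieve
import HarnessLib

/-!
# Heath-Brown's Lemma 3.5, II: the Fundamental-Lemma set-up for `ℬ` (cf. (6.4)–(6.6), pp. 35–37)

Second file of the proof of the named fact `HeathBrown2001_lemma_3_5`
(`HeathBrownCubicSieveDecomposition`; D. R. Heath-Brown, *Primes represented by `x³ + 2y³`*, Acta
Math. 186 (2001), Lemma 3.5, proved in §6), continuing `HeathBrownCubicFLSequencesA` (the `𝒜`-side).
Here the terms `T^(n)(ℬ) = ∑_{s} S_K(ℬ^(K)_{∏s}, X^τ)` are connected EXACTLY to the sifted *window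
sequences* of `HeathBrownCubicNormWindowSieve` (`windowSeq Y η`: the multiset of norms of the ideals
`J'` with `Y < N(J') ≤ Y(1+η)`, size `γ₀ηY`, density `normDensity`, whose remainders and dimension are
estimated there from the Weber–Landau count), so that the tree's two-sided Fundamental Lemma
(`Literature.NumberTheory.Sieve.SieveSequence.fundamental_lemma_uniform_holds`) applies to them.
Everything is PROVED; no definition and no named fact is introduced.

Where the paper passes from `T^(n)(ℬ)` to the rational sums `T_0^(n)(ℬ) = ∑ S(ℬ_{p_1⋯p_n}, X^τ)` with
an error ((6.4)–(6.5), pp. 35–36), we use the exact reduction available over `K`: the members of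
`ℬ^(K)_R` are the ideals `R·J'` (unique factorisation), and for `R` all of whose prime factors have
norm `≥ z` (in (3.1), `R = P_1⋯P_n` with `N(P_i) ≥ X^τ = z`) the ideal `R·J'` is `z`-rough iff `J'`
is; hence **`S_K(ℬ^(K)_R, z) = #{J' : Y < N(J') ≤ Y(1+η), J' z-rough}`, `Y = 3X³/N(R)`**
(`famSifted_normWindow_eq`). The window sequence sifted by the rational primes `< z` counts instead
the `J'` with `(N(J'), P(z)) = 1`; these are `z`-rough, and a `z`-rough `J'` fails to be counted only
if it has a prime factor `P` of degree `≥ 2` above some `p < z ≤ N(P)` (the phenomenon of (6.4):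
"unless `P ∣ J` for some second degree prime ideal with `N(P) = p² ∈ [z, z²)`, or for some inert prime
ideal `P` with `N(P) = p³ ∈ [z, z³)`", p. 35). The discrepancy is therefore between `0` and
`∑_{p<z} ∑_{P∣p, N(P)≥z} #{J' : P ∣ J'}`, each count being a `#ℬ^(K)_{RP}`
(`card_isRough_sub_sifted_mem_Icc`, `card_idealWindow_dvd_eq_countB`), which the assembly bounds by
`C_ℬX³/(N(R)N(P))` (`exists_countB_le`).

## Content (namespace `Literature.NumberTheory.Sieve.CubicSieve`), all proved

* `card_idealWindow_filter_eq` — `J' ↦ R·J'` identifies conditions on the window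
  `idealWindow (3X³/N(R)) η` with conditions on `ℬ^(K)_R`; `isRough_mul_iff_right`;
  **`famSifted_normWindow_eq`**; `card_idealWindow_dvd_eq_countB` (`#{J' : E ∣ J'} = #ℬ^(K)_{RE}`).
* `isRough_of_coprime_absNorm` (`(N(J), P(z)) = 1 ⇒ J` is `z`-rough),
  **`card_isRough_sub_sifted_mem_Icc`** (the degree-`≥ 2` discrepancy, for any window `Y ≥ 0`).

## References

* D. R. Heath-Brown, *Primes represented by `x³ + 2y³`*, Acta Math. 186 (2001), 1–84: §6 (6.4)–(6.6),
  pp. 35–37. [cite: HeathBrownActa2001, §6 (6.4)–(6.6)]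

## Mathlib / tree search

Mathlib: `Finset.card_bij`, `Ideal.IsPrime.mul_le`, `mul_left_cancel₀` (ideals of a Dedekind domain),
`Finset.card_biUnion_le`, `Finset.card_sdiff_of_subset`. Tree: `HeathBrownCubicNormWindowSieve`
(`idealWindow`, `mem_idealWindow_iff`, `ne_bot_of_mem_idealWindow`, `windowSeq`, `windowSeq_sifted`,
`primesAbove`, `mem_primesAbove_iff`, `dvd_absNorm_iff_exists_mem_primesAbove`),
`HeathBrownCubicFLSequencesA` (`ne_bot_of_dvd_ne_bot`, `exists_absNorm_eq_prime_pow'`),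
`HeathBrownCubicSieveSetup` (`normWindow`, `countB`, `BIdeals`, `IsRough`),
`HeathBrownCubicSieveDecomposition` (`famSifted`), `SieveFramework` (`coprime_primesProdBelow_iff`).
-/

noncomputable section

open Polynomial NumberField Finset Filter Topology

namespace Literature.NumberTheory.Sieve.CubicSieve

open LFunctions.CubeRootTwoField CubicPrimes

/-! ### `ℬ^(K)_R` as a norm window for the cofactor: `J = R·J'` -/

open scoped Classical in
/-- **`J' ↦ R·J'` identifies conditions on the cofactor window with conditions on `ℬ^(K)_R`.** For
`R ≠ 0` and predicates `c`, `c'` with `c'(R·J') ↔ c(J')`: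
`#{J' : 3X³/N(R) < N(J') ≤ (3X³/N(R))(1+η), c J'} = #{J ∈ ℬ^(K) : R ∣ J, c' J}` (the members of
`ℬ^(K)_R` are the `R·J'`, unique factorisation of ideals). [folklore] -/
theorem card_idealWindow_filter_eq {X η : ℝ} {R : Ideal (𝓞 K)} (hR0 : R ≠ ⊥)
    {c c' : Ideal (𝓞 K) → Prop} (hcc' : ∀ J', c' (R * J') ↔ c J') :
    #{J' ∈ idealWindow (3 * X ^ 3 / Ideal.absNorm R) η | c J'} =
      #{J ∈ normWindow X η | R ∣ J ∧ c' J} := by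
  have hNR : (0 : ℝ) < Ideal.absNorm R := by
    have : Ideal.absNorm R ≠ 0 := fun h => hR0 (Ideal.absNorm_eq_zero_iff.mp h)
    positivity
  have hwin : ∀ J' : Ideal (𝓞 K), J' ∈ idealWindow (3 * X ^ 3 / Ideal.absNorm R) η ↔
      R * J' ∈ normWindow X η := by
    intro J'
    rw [mem_idealWindow_iff, mem_normWindow_iff, map_mul, Nat.cast_mul, div_mul_eq_mul_div,
      div_lt_iff₀ hNR, le_div_iff₀ hNR]
    constructor <;> rintro ⟨h1, h2⟩ <;> constructor <;> nlinarith
  refine card_bij (fun J' _ => R * J') (fun J' hJ' => ?_) (fun J₁ _ J₂ _ h => mul_left_cancel₀ hR0 h)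
    (fun J hJ => ?_)
  · rw [mem_filter] at hJ' ⊢
    exact ⟨(hwin J').mp hJ'.1, dvd_mul_right R J', (hcc' J').mpr hJ'.2⟩
  · rw [mem_filter] at hJ
    obtain ⟨hw, ⟨J', rfl⟩, hc'⟩ := hJ
    exact ⟨J', mem_filter.mpr ⟨(hwin J').mpr hw, (hcc' J').mp hc'⟩, rfl⟩

/-- Roughness of `R·J'` for `z`-rough `R`: `R·J'` is `z`-rough iff `J'` is (a prime ideal dividing a
product divides a factor). [folklore] -/
theorem isRough_mul_iff_right {z : ℝ} {R J' : Ideal (𝓞 K)} (hR : IsRough z R) :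
    IsRough z (R * J') ↔ IsRough z J' := by
  constructor
  · exact fun h P hP hPJ' => h hP (hPJ'.mul_left R)
  · intro h P hP hPRJ'
    rcases (hP.mul_le).mp (Ideal.dvd_iff_le.mp hPRJ') with h1 | h1
    · exact hR hP (Ideal.dvd_iff_le.mpr h1)
    · exact h hP (Ideal.dvd_iff_le.mpr h1)

open scoped Classical in
/-- **`S_K(ℬ^(K)_R, z) = #{J' : Y < N(J') ≤ Y(1+η), J' z-rough}`, `Y = 3X³/N(R)`,** for `R ≠ 0` all of
whose prime factors have norm `≥ z` (in (3.1), `R = P_1⋯P_n` with `N(P_i) ≥ X^τ = z`): the members of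
`ℬ^(K)_R` are the `R·J'`, and `R·J'` is `z`-rough iff `J'` is. This exact identity replaces the
approximate passage (6.4)–(6.6) to `T_0^(n)(ℬ)` of the paper. [cite: HeathBrownActa2001, §6 (6.4)–(6.6)] -/
theorem famSifted_normWindow_eq {X η z : ℝ} {R : Ideal (𝓞 K)} (hR0 : R ≠ ⊥) (hR : IsRough z R) :
    famSifted (normWindow X η) (fun J => J) R z =
      #{J' ∈ idealWindow (3 * X ^ 3 / Ideal.absNorm R) η | IsRough z J'} := by
  rw [famSifted, card_idealWindow_filter_eq hR0 fun J' => isRough_mul_iff_right hR]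

open scoped Classical in
/-- `#{J' in the cofactor window : E ∣ J'} = #ℬ^(K)_{RE}` for `R ≠ 0`. [folklore] -/
theorem card_idealWindow_dvd_eq_countB {X η : ℝ} {R : Ideal (𝓞 K)} (hR0 : R ≠ ⊥) (E : Ideal (𝓞 K)) :
    #{J' ∈ idealWindow (3 * X ^ 3 / Ideal.absNorm R) η | E ∣ J'} = countB X η (R * E) := by
  rw [card_idealWindow_filter_eq hR0 (c' := fun J => R * E ∣ J) fun J' => mul_dvd_mul_iff_left hR0,
    countB, BIdeals]
  congr 1
  exact filter_congr fun J _ => ⟨fun h => h.2, fun h => ⟨(dvd_mul_right R E).trans h, h⟩⟩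

/-! ### Rough cofactors versus cofactors with rough norm: the degree `≥ 2` discrepancy -/

/-- If `(N(J), P(z)) = 1` then `J` is `z`-rough (a prime factor `P` has norm `p^f` with `p ∣ N(J)`,
so `p ≥ z`). [folklore] -/
theorem isRough_of_coprime_absNorm {z : ℝ} {J : Ideal (𝓞 K)} (hJ : J ≠ ⊥)
    (h : (Ideal.absNorm J).Coprime (primesProdBelow z)) : IsRough z J := by
  intro P hP hPJ
  have hP0 := ne_bot_of_dvd_ne_bot hJ hPJ
  obtain ⟨q, f, hq, hf, hN⟩ := exists_absNorm_eq_prime_pow' hP hP0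
  have hqN : q ∣ Ideal.absNorm J :=
    (dvd_pow_self q hf.ne').trans (hN ▸ Ideal.absNorm_dvd_absNorm_of_le (Ideal.dvd_iff_le.mp hPJ))
  rw [coprime_primesProdBelow_iff] at h
  have hzq : z ≤ q := by
    by_contra hlt
    exact h q (Nat.mem_primesBelow.mpr ⟨Nat.lt_ceil.mpr (not_le.mp hlt), hq⟩) hqN
  calc z ≤ q := hzq
    _ ≤ (Ideal.absNorm P : ℝ) := by rw [hN]; exact_mod_cast Nat.le_self_pow hf.ne' q

open scoped Classical in
/-- **The rough ideals of a window not counted by the sieve on the norms are few**: for `Y ≥ 0`,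
`0 ≤ #{J ∈ idealWindow Y η : J z-rough} − S(windowSeq Y η, P(z))
  ≤ ∑_{p < z} ∑_{P ∣ p, N(P) ≥ z} #{J ∈ idealWindow Y η : P ∣ J}`,
where `S(windowSeq Y η, P(z)) = #{J : (N(J), P(z)) = 1}` (`windowSeq_sifted`): such a `J` has a prime
factor `P` of degree `≥ 2` above some `p < z` with `N(P) ≥ z` — the phenomenon behind (6.4) ("unless
`P ∣ J` for some second degree prime ideal with `N(P) = p² ∈ [z, z²)`, or for some inert prime ideal
`P` with `N(P) = p³ ∈ [z, z³)`", p. 35). [cite: HeathBrownActa2001, §6 (6.4)] -/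
theorem card_isRough_sub_sifted_mem_Icc {Y η : ℝ} (hY : 0 ≤ Y) (z : ℝ) :
    ((#{J ∈ idealWindow Y η | IsRough z J} : ℕ) : ℝ) -
        (windowSeq Y η).sifted (Y * (1 + η)) (primesProdBelow z) ∈
      Set.Icc (0 : ℝ) (∑ p ∈ Nat.primesBelow ⌈z⌉₊, ∑ P ∈ (primesAbove p).filter
        (fun P => z ≤ (Ideal.absNorm P : ℝ)), (#{J ∈ idealWindow Y η | P ∣ J} : ℝ)) := by
  rw [windowSeq_sifted hY le_rfl]
  set A := ({J ∈ idealWindow Y η | IsRough z J} : Finset (Ideal (𝓞 K))) with hA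
  set B := ({J ∈ idealWindow Y η | (Ideal.absNorm J).Coprime (primesProdBelow z)} :
    Finset (Ideal (𝓞 K))) with hB
  have hBA : B ⊆ A := by
    intro J hJ
    rw [hB, mem_filter] at hJ
    rw [hA, mem_filter]
    exact ⟨hJ.1, isRough_of_coprime_absNorm (ne_bot_of_mem_idealWindow hY hJ.1) hJ.2⟩
  have hdiff : ((#A : ℕ) : ℝ) - #B = ((#(A \ B) : ℕ) : ℝ) := by
    rw [card_sdiff_of_subset hBA, Nat.cast_sub (card_le_card hBA)]
  rw [hdiff, Set.mem_Icc]
  refine ⟨Nat.cast_nonneg _, ?_⟩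
  -- `A ∖ B` is covered by the sets `{J : P ∣ J}`, `P` above `p < z` with `N(P) ≥ z`
  have hcover : A \ B ⊆ (Nat.primesBelow ⌈z⌉₊).biUnion fun p =>
      ((primesAbove p).filter fun P => z ≤ (Ideal.absNorm P : ℝ)).biUnion
        fun P => {J ∈ idealWindow Y η | P ∣ J} := by
    intro J hJ
    rw [Finset.mem_sdiff, hA, hB, mem_filter, mem_filter, not_and] at hJ
    obtain ⟨⟨hJw, hJr⟩, hJc⟩ := hJ
    have hJ0 := ne_bot_of_mem_idealWindow hY hJw
    have hnc := hJc hJw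
    rw [coprime_primesProdBelow_iff] at hnc
    push Not at hnc
    obtain ⟨q, hq, hqN⟩ := hnc
    have hqp := (Nat.mem_primesBelow.mp hq).2
    obtain ⟨P, hP, hPJ⟩ := (dvd_absNorm_iff_exists_mem_primesAbove hqp hJ0).mp hqN
    simp only [mem_biUnion, mem_filter]
    exact ⟨q, hq, P, ⟨hP, hJr ((mem_primesAbove_iff hqp).mp hP).1 hPJ⟩, hJw, hPJ⟩
  calc ((#(A \ B) : ℕ) : ℝ) ≤ #((Nat.primesBelow ⌈z⌉₊).biUnion fun p =>
        ((primesAbove p).filter fun P => z ≤ (Ideal.absNorm P : ℝ)).biUnion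
          fun P => {J ∈ idealWindow Y η | P ∣ J}) := by exact_mod_cast card_le_card hcover
    _ ≤ ∑ p ∈ Nat.primesBelow ⌈z⌉₊, (#(((primesAbove p).filter fun P => z ≤ (Ideal.absNorm P : ℝ)).biUnion
          fun P => {J ∈ idealWindow Y η | P ∣ J}) : ℝ) := by exact_mod_cast card_biUnion_le
    _ ≤ _ := sum_le_sum fun p _ => by exact_mod_cast card_biUnion_le

end Literature.NumberTheory.Sieve.CubicSieve

end
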